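import Mathlib
import Literature.NumberTheory.Automorphic.BCDTModularity
import Literature.NumberTheory.GaloisRepresentations.AdequateSubgroup

/-!
# Stub ideas k2 GEN 15 for `stub_liftFive` (crux `FreyModularity`, route `DefiniteXi`) — companion

FAMILY 2 — RESHAPE, technique **T-δ (image-side reshape of the Taylor–Wiles input at `ℓ = 5`)**.
The stub's hypothesis `ρ.IsAbsIrreducibleOverSqrt 5` (+ `det ρ̄_{E,5} = χ̄₅`, tree
`WeierstrassCurve.det_eq_modPCyclotomicCharacter_of_isTorsionGaloisRep_holds`) is exactly the
hypothesis "`ρ̄|_{G_L}` absolutely irreducible, `L = ℚ(√5)`" of DDT Thm. 2.49 (existence of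
Taylor–Wiles primes), the one place in every `R = T` engine behind `CDT_theorem_7_2_2` where
`ℓ = 5` is SPECIAL: DDT Lemma 2.48 / [CPS] Table 4.5 — `H¹(SL₂(F), End⁰) = 0` iff `#F ≠ 5`.
We re-type the three cohomological inputs of the proof of Thm. 2.49 (pp. 83–84) as FINITE-GROUP
statements about `G = im ρ̄ ≤ GL₂(𝔽₅)` acting on `W = 𝔰𝔩₂(𝔽₅)(1)` (`g • X = det g · g X g⁻¹`),
provable now over `ZMod 5`, and record the TRAP: `SL₂(𝔽₅) = ρ̄_{E,5}(Γ_{ℚ(ζ₅)})` (semistable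
Frey curve, `im ρ̄ = GL₂(𝔽₅)`) is NOT Thorne-adequate (clause (iii) fails), so no `R = T` port
whose interface is `Subgroup.IsThorneAdequate` / `IsEnormous` can serve this stub's consumer.

Helper statements (sizes in the memo `STUB-IDEAS-stub_liftFive-2.md`; `sorry` = to be proved;
the `decide` lemmas are sanity certificates of the concrete matrices):
* L1 `twAd`, `IsTwCocycle`, `IsTwCoboundary`, `TwH1Vanishes` — `H¹(H, M₂(𝔽₅)(1)) = 0` in the
  explicit form of tree `cocycles₁_le_coboundaries₁_iff_forall`.
* L2 `eq_top_of_five_dvd_card` — Dickson-lite dichotomy in `GL₂(𝔽₅)`.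
* L3 `twH1Vanishes_of_two_smul_one_mem` — the central element `2·1` (acting by `det = 4 = -1`
  on `W`) kills every twisted cocycle (= DDT p. 84 "unless Gal(F₀/ℚ) has Gal(ℚ(ζ_ℓ)/ℚ) as a
  quotient" = Kisin (3.2.3)(3), tree `TaylorWilesHypothesisFive`).
* L4 `twH1Vanishes_of_not_five_dvd_card` — averaging.
* L5 `twInvariants_eq_zero_*` — `W^G = 0`.
* L6 `exists_noncentral_comm_of_semisimple_span` — the Chebotarev-step supply (`σ₀` of DDT p. 84)
  from ANY spanning set of semisimple elements (adequacy clause (iv) flavour, no `H¹` needed).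
* L7 `span_detOne_eq_top` — "`ρ̄|_{ℚ(√5)}` abs. irreducible ⇒ `ρ̄|_{ℚ(ζ₅)}` abs. irreducible"
  (DDT p. 84, first line of the last paragraph) as a statement about `det`-fibres in `GL₂(𝔽₅)`.
* L8 `q8_*` — the semisimple spanning quadruple `1, d, s, ds ∈ SL₂(𝔽₅)` (regime `im = GL₂(𝔽₅)`).
* L9 `not_isThorneAdequate_detKer` — the trap certificate (DDT L. 2.48, `#F = 5`).
* B0 `span_sqDet_eq_top_of_isAbsIrreducibleOverSqrt` — Galois → group bridge for the stub's binder.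
-/

namespace Summit.ABC.ABC.Cruxes.FreyModularity.StubIdeas.LiftFive2g15

open Matrix
open Literature.NumberTheory.GaloisRepresentations Literature.NumberTheory.Automorphic

/-- `𝔽₅`. -/
abbrev F5 := ZMod 5
/-- `M₂(𝔽₅)`. -/
abbrev M2 := Matrix (Fin 2) (Fin 2) (ZMod 5)
/-- `GL₂(𝔽₅)`. -/
abbrev G5 := GL (Fin 2) (ZMod 5)

/-! ### L1 — the Tate-twisted adjoint action and explicit `H¹` -/

/-- **`ad ρ̄(1)`-action of `GL₂(𝔽₅)` on `M₂(𝔽₅)`**: `g • X = det g · g X g⁻¹` (for `ρ̄ = ρ̄_{E,5}`,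
`det ρ̄ = χ̄₅ = ε̄`, so this IS `ad ρ̄ ⊗ ε̄`; its trace-zero part is DDT's `ad⁰ρ̄(1)`). -/
def twAd (g : G5) (X : M2) : M2 :=
  ((Matrix.GeneralLinearGroup.det g : (ZMod 5)ˣ) : ZMod 5) • ((g : M2) * X * ((g⁻¹ : G5) : M2))

/-- Inhomogeneous `1`-cocycle `f : H → M₂(𝔽₅)(1)` (shape of tree
`cocycles₁_le_coboundaries₁_iff_forall`: `f (g h) = g • f h + f g`). -/
def IsTwCocycle (H : Subgroup G5) (f : H → M2) : Prop :=
  ∀ g h : H, f (g * h) = twAd (g : G5) (f h) + f g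

/-- `1`-coboundary: `f g = g • m - m`. -/
def IsTwCoboundary (H : Subgroup G5) (f : H → M2) : Prop :=
  ∃ m : M2, ∀ g : H, f g = twAd (g : G5) m - m

/-- **`H¹(H, M₂(𝔽₅)(1)) = 0`** (hence `H¹(H, 𝔰𝔩₂(𝔽₅)(1)) = 0`, a direct summand as `2 ∈ 𝔽₅ˣ`). -/
def TwH1Vanishes (H : Subgroup G5) : Prop :=
  ∀ f : H → M2, IsTwCocycle H f → IsTwCoboundary H f

/-- `H` has no stable line in `𝔽₅²` (irreducible over `𝔽₅`). -/
def ActsIrreducibly (H : Subgroup G5) : Prop :=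
  ∀ v : Fin 2 → ZMod 5, v ≠ 0 → ∃ g : H, ∀ c : ZMod 5, ((g : G5) : M2).mulVec v ≠ c • v

/-- `det : H → 𝔽₅ˣ` is onto (for `ρ̄_{E,5}` over `ℚ`: `χ̄₅` onto, tree
`modPCyclotomicCharacterZMod_rat_surjective`). -/
def DetSurjective (H : Subgroup G5) : Prop :=
  ∀ d : (ZMod 5)ˣ, ∃ g : H, Matrix.GeneralLinearGroup.det (g : G5) = d

/-- The matrices of the elements of `H` with `det g = 1` (image of `Γ_{ℚ(ζ₅)}`), resp.
`det g = ±1` (image of `Γ_{ℚ(√5)}`), as subsets of `M₂(𝔽₅)`. -/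
def detOneMatrices (H : Subgroup G5) : Set M2 :=
  (fun g : G5 => (g : M2)) '' {g : G5 | g ∈ H ∧ Matrix.GeneralLinearGroup.det g = 1}

/-- See `detOneMatrices`. -/
def sqDetMatrices (H : Subgroup G5) : Set M2 :=
  (fun g : G5 => (g : M2)) '' {g : G5 | g ∈ H ∧ Matrix.GeneralLinearGroup.det g ^ 2 = 1}

/-! ### L2 — Dickson-lite dichotomy (size S–M) -/

/-- **L2.** An irreducible `H ≤ GL₂(𝔽₅)` with `det` onto and `5 ∣ |H|` is everything: an element of
order `5` is a transvection, irreducibility gives a second transvection with a different axis, two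
such generate `SL₂(𝔽₅)` (tree `closure_transvection_eq_top`, or the word-table `decide` idiom of
`STUB_IDEAS_stub_liftThree_3g4`), and `det` onto fills the cosets (Serre 1972, Prop. 15; DDT
Thm. 2.47 (c)). [cite: DarmonDiamondTaylor1995, Thm. 2.47] -/
theorem eq_top_of_five_dvd_card (H : Subgroup G5) (hirr : ActsIrreducibly H)
    (hdet : DetSurjective H) (h5 : 5 ∣ Nat.card H) : H = ⊤ := by
  sorry

/-! ### L3/L4 — term (A) of DDT p. 83–84: `H¹(Gal(F_n/ℚ), ad⁰ρ̄(1)) = 0` at `ℓ = 5` -/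

/-- Sanity certificate for L3: the scalar `2·1` acts on `M₂(𝔽₅)(1)` by `det(2·1) = 4 = -1`. -/
theorem twAd_two_smul_one (z : G5) (hz : (z : M2) = (2 : ZMod 5) • (1 : M2)) (X : M2) :
    twAd z X = -X := by
  have hinv : ((z⁻¹ : G5) : M2) = (3 : ZMod 5) • (1 : M2) := by
    have h1 : (z : M2) * ((z⁻¹ : G5) : M2) = 1 := by
      rw [← Matrix.GeneralLinearGroup.coe_mul, mul_inv_cancel, Matrix.GeneralLinearGroup.coe_one]
    have h2 : ((3 : ZMod 5) • (1 : M2)) * ((z : M2) * ((z⁻¹ : G5) : M2)) = ((z⁻¹ : G5) : M2) := by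
      rw [← mul_assoc, hz, smul_mul_smul_comm, mul_one]
      have : (3 : ZMod 5) * 2 = 1 := by decide
      rw [this, one_smul, one_mul]
    rw [h1, mul_one] at h2
    exact h2.symm
  have hdet : ((Matrix.GeneralLinearGroup.det z : (ZMod 5)ˣ) : ZMod 5) = 4 := by
    rw [Matrix.GeneralLinearGroup.val_det_apply, hz]
    simp [Fintype.card_fin]
    decide
  unfold twAd
  rw [hdet, hz, hinv]
  simp only [smul_mul_assoc, one_mul, mul_smul_comm, mul_one, smul_smul]
  rw [show (4 : ZMod 5) * (3 * 2) = -1 from by decide, neg_one_smul]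

/-- **L3 (XS–S).** If `2·1 ∈ H` then `H¹(H, M₂(𝔽₅)(1)) = 0`: for a cocycle `f` and central `z = 2·1`
acting by `-1`, `f(gz) = f(zg)` gives `2 f(g) = (1 - g•) f(z)`, i.e. `f g = g • m - m` with
`m = 2 f(z)` (`-1/2 = 2` in `𝔽₅`).  This is the group-theoretic content of "the first term vanishes
unless Gal(F₀/ℚ) has Gal(ℚ(ζ₅)/ℚ) as a quotient" (DDT p. 84) = Kisin (3.2.3)(3) (tree
`TaylorWilesHypothesisFive`): `2·1 ∈ im ρ̄` is a `γ ∈ ker(proj ρ̄)` with `χ̄₅(γ) = 4 ≠ 1`.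
[cite: DarmonDiamondTaylor1995, Thm. 2.49 (proof, p. 84)] -/
theorem twH1Vanishes_of_two_smul_one_mem (H : Subgroup G5)
    (h2 : ∃ z : H, ((z : G5) : M2) = (2 : ZMod 5) • (1 : M2)) : TwH1Vanishes H := by
  sorry

/-- **L4 (S).** If `5 ∤ |H|` then `H¹(H, M₂(𝔽₅)(1)) = 0` (averaging: `m = -|H|⁻¹ ∑ₕ f h`).
[folklore] -/
theorem twH1Vanishes_of_not_five_dvd_card (H : Subgroup G5) (h5 : ¬ 5 ∣ Nat.card H) :
    TwH1Vanishes H := by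
  sorry

/-! ### L5 — term (B): `(ad⁰ρ̄(1))^{G_ℚ} = 0` -/

/-- **L5a (XS).** `2·1 ∈ H` ⇒ no non-zero `H`-invariant in `M₂(𝔽₅)(1)`. [folklore] -/
theorem twInvariants_eq_zero_of_two_smul_one_mem (H : Subgroup G5)
    (h2 : ∃ z : H, ((z : G5) : M2) = (2 : ZMod 5) • (1 : M2)) (X : M2)
    (hX : ∀ g : H, twAd (g : G5) X = X) : X = 0 := by
  obtain ⟨z, hz⟩ := h2
  have h := hX z
  rw [twAd_two_smul_one (z : G5) hz] at h
  have h2X : (2 : ZMod 5) • X = 0 := by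
    rw [two_smul]
    nth_rewrite 1 [← h]
    exact neg_add_cancel X
  exact (smul_eq_zero.mp h2X).resolve_left (by decide)

/-- **L5b (S).** If the `det = 1` part of `H` spans `M₂(𝔽₅)` then a trace-zero `H`-invariant of
`M₂(𝔽₅)(1)` is `0` (it commutes with a spanning set, hence is scalar, hence `0`). [folklore] -/
theorem twInvariants_eq_zero_of_span_detOne (H : Subgroup G5)
    (hspan : Submodule.span (ZMod 5) (detOneMatrices H) = ⊤) (X : M2) (htr : X.trace = 0)
    (hX : ∀ g : H, twAd (g : G5) X = X) : X = 0 := by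
  sorry

/-! ### L6 — the Chebotarev-step supply (DDT p. 84, last paragraph) -/

/-- Semisimple-or-central test in `GL₂` over a field of characteristic `≠ 2`: distinct eigenvalues
(`tr² ≠ 4 det`) or `g = ±1`. -/
def IsSemisimpleElt (g : G5) : Prop :=
  (g : M2).trace ^ 2 ≠ 4 * (g : M2).det ∨ (g : M2) = 1 ∨ (g : M2) = -1

/-- **L6 (S–M).** If a finite set `S` of semisimple elements spans `M₂(𝔽₅)` then every non-zero
subspace `N` of trace-zero matrices stable under conjugation by `S` contains a non-zero matrix
commuting with some NON-CENTRAL `g ∈ S`.  Proof: otherwise `N` meets no Cartan line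
`ker(Ad g - 1)`, so (eigenspace decomposition of the semisimple `Ad g`, invariance of the trace
form) `N ⊆ (𝔽₅ g⁰)^⊥` for every `g ∈ S` (`g⁰` = trace-free part), and the `g⁰` span `𝔰𝔩₂`, whose
trace form is non-degenerate (`char ≠ 2`): `N = 0`.  This is DDT's "some `g` of order not dividing
`ℓ` fixes a non-zero element of `ψ(G_{F_n})`" with the group replaced by a spanning semisimple
SET — the form that survives at `ℓ = 5` (GHTT: adequacy clause (iv) ⟺ semisimple elements span).
[cite: DarmonDiamondTaylor1995, Thm. 2.49 (proof, p. 84)] -/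
theorem exists_noncentral_comm_of_semisimple_span (S : Finset G5)
    (hss : ∀ g ∈ S, IsSemisimpleElt g)
    (hspan : Submodule.span (ZMod 5) ((fun g : G5 => (g : M2)) '' (S : Set G5)) = ⊤)
    (N : Submodule (ZMod 5) M2) (hN0 : N ≠ ⊥) (hNtr : ∀ X ∈ N, X.trace = 0)
    (hNstab : ∀ g ∈ S, ∀ X ∈ N, (g : M2) * X * ((g⁻¹ : G5) : M2) ∈ N) :
    ∃ g ∈ S, (g : M2) ≠ 1 ∧ (g : M2) ≠ -1 ∧ ∃ X ∈ N, X ≠ 0 ∧ (g : M2) * X = X * (g : M2) := by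
  sorry

/-! ### L7 — `ρ̄|_{ℚ(√5)}` abs. irreducible ⇒ `ρ̄|_{ℚ(ζ₅)}` abs. irreducible (regime `5 ∤ |G|`) -/

/-- **L7 (S–M).** `det` onto `𝔽₅ˣ ≅ ℤ/4`, `5 ∤ |H|`, and the `det = ±1` part of `H` spanning
`M₂(𝔽₅)` force the `det = 1` part to span `M₂(𝔽₅)` too: otherwise `H¹ := H ∩ SL₂` (semisimple,
normal) lies in a Cartan `C`; the stabiliser `H_C` of its eigenline pair has index `2`, so
`det(H_C) ⊇ {±1}` gives `c ∈ H_C` with `det c = -1`, while a line-swapping `s` with `det s = ±1`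
exists by irreducibility of the `±1` part — then `s` or `sc` is a swapping element of `H¹ ⊆ C`,
absurd.  (DDT p. 84: "since `ρ̄|_{G_L}` is absolutely irreducible, so is `ρ̄|_{G_{ℚ(ζ_{ℓⁿ})}}`",
stated there without proof; at `ℓ = 5`, `[ℚ(ζ₅) : ℚ(√5)] = 2` and this is its content.)
[cite: DarmonDiamondTaylor1995, Thm. 2.49 (proof, p. 84)] -/
theorem span_detOne_eq_top (H : Subgroup G5) (h5 : ¬ 5 ∣ Nat.card H) (hdet : DetSurjective H)
    (hsq : Submodule.span (ZMod 5) (sqDetMatrices H) = ⊤) :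
    Submodule.span (ZMod 5) (detOneMatrices H) = ⊤ := by
  sorry

/-! ### L8 — the semisimple spanning quadruple in `SL₂(𝔽₅)` (regime `im ρ̄ = GL₂(𝔽₅)`) -/

/-- `d = diag(2, 3) ∈ SL₂(𝔽₅)` (order `4`). -/
def dMat : M2 := !![2, 0; 0, 3]
/-- `s = (0 1; 4 0) ∈ SL₂(𝔽₅)` (order `4`, `s² = -1`). -/
def sMat : M2 := !![0, 1; 4, 0]

/-- **L8a (XS, decide).** `d, s, ds` have determinant `1` and trace `0` (so `tr² = 0 ≠ 4 = 4·det`: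
semisimple with distinct eigenvalues, non-central), and `d⁴ = s⁴ = 1`. -/
theorem q8_facts :
    dMat.det = 1 ∧ sMat.det = 1 ∧ (dMat * sMat).det = 1 ∧
    dMat.trace = 0 ∧ sMat.trace = 0 ∧ (dMat * sMat).trace = 0 ∧
    dMat ^ 4 = 1 ∧ sMat ^ 4 = 1 ∧ sMat ^ 2 = -1 := by
  refine ⟨?_, ?_, ?_, ?_, ?_, ?_, ?_, ?_, ?_⟩
  · simp [dMat, Matrix.det_fin_two]; decide
  · simp [sMat, Matrix.det_fin_two]; decide
  · simp [dMat, sMat, Matrix.det_fin_two]; decide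
  · simp [dMat, Matrix.trace_fin_two]; decide
  · simp [sMat, Matrix.trace_fin_two]
  · simp [dMat, sMat, Matrix.trace_fin_two]
  · decide +kernel
  · decide +kernel
  · decide +kernel

/-- **L8b (XS, decide).** `1, d, s, ds` are linearly independent, hence span `M₂(𝔽₅)`. -/
theorem q8_linearIndependent :
    ∀ a b c e : ZMod 5, a • (1 : M2) + b • dMat + c • sMat + e • (dMat * sMat) = 0 →
      a = 0 ∧ b = 0 ∧ c = 0 ∧ e = 0 := by
  decide +kernel

/-! ### L9 — the adequacy TRAP at `ℓ = 5` -/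

/-- `SL₂(𝔽₅) ≤ GL₂(𝔽₅)` as `ker det` (= `ρ̄_{E,5}(Γ_{ℚ(ζ₅)})` when `im ρ̄_{E,5} = GL₂(𝔽₅)`, since
`det ρ̄_{E,5} = χ̄₅` and `Γ_{ℚ(ζ₅)} = ker χ̄₅`). -/
abbrev detKer : Subgroup G5 := (Matrix.GeneralLinearGroup.det : G5 →* (ZMod 5)ˣ).ker

/-- **L9 (S–M; documentary, kills the adequacy-based ports).** `SL₂(𝔽₅) < GL₂(𝔽₅)` is NOT
adequate in Thorne's sense at `p = 5`: clause (iii) `H¹(SL₂(𝔽₅), 𝔰𝔩₂(𝔽₅)) = 0` fails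
(DDT Lemma 2.48 / [CPS] Table 4.5: it is `𝔽₅`; a non-principal cocycle comes from the uniserial
permutation module `𝔽₅⁵ ⊋ (sum 0) ⊋ 𝔽₅·(1,…,1)` of `A₅ ≅ PSL₂(𝔽₅)`, inflated).  Route: exhibit the
cocycle on the two generators, extend by the word table, `decide`; or port the `1 | 3 | 1` module.
[cite: DarmonDiamondTaylor1995, Lemma 2.48] -/
theorem not_isThorneAdequate_detKer [Fact (Nat.Prime 5)] :
    ¬ Subgroup.IsThorneAdequate (k := ZMod 5) (n := 2) detKer := by
  sorry

/-! ### B0 — bridge from the stub's binder to the group-level hypotheses -/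

/-- **B0 (S–M).** For `ρ̄ = ρ̄_{E,5}` framed (`IsTorsionGaloisRep 5`), `ρ̄|_{ℚ(√5)}` absolutely
irreducible ⇒ the `det = ±1` part of `im ρ̄` spans `M₂(𝔽₅)`: `ρ̄(Γ_{ℚ(√5)}) = im ρ̄ ∩ det⁻¹{±1}`
because `det ρ̄ = χ̄₅` (tree `det_eq_modPCyclotomicCharacter_of_isTorsionGaloisRep_holds`) and
`ℚ(√5) ⊂ ℚ(ζ₅)` is cut out by `χ̄₅² = 1`; absolute irreducibility of a subgroup of `GL₂` ⟺ its
matrices span `M₂` (Burnside, `n = 2` by hand: a proper subalgebra of `M₂(k)` has a common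
eigenvector over a quadratic extension).  Also `DetSurjective (im ρ̄)` by
`modPCyclotomicCharacterZMod_rat_surjective`. [folklore] -/
theorem span_sqDet_eq_top_of_isAbsIrreducibleOverSqrt [Fact (Nat.Prime 5)]
    (W : WeierstrassCurve ℚ) [W.IsElliptic] {ρ : ModPGaloisRep ℚ (ZMod 5) 2}
    (hρ : W.IsTorsionGaloisRep 5 ρ) (hirr : ρ.IsAbsIrreducibleOverSqrt 5) :
    Submodule.span (ZMod 5) (sqDetMatrices ρ.toMonoidHom.range) = ⊤ ∧
      DetSurjective ρ.toMonoidHom.range := by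
  sorry

/-! ### Assembly (statement-level): the three inputs of DDT Thm. 2.49 at `ℓ = 5` for `G = im ρ̄` -/

/-- **T-δ package.** For `G ≤ GL₂(𝔽₅)` with `det` onto and `det = ±1` part spanning (the consumer's
provable shape, B0): (A) `H¹(G, M₂(𝔽₅)(1)) = 0`, (B) `(𝔰𝔩₂(𝔽₅)(1))^G = 0`, (C) every non-zero
`G`-stable `N ≤ 𝔰𝔩₂(𝔽₅)(1)` has a non-zero element centralised by a non-central `g ∈ G ∩ SL₂(𝔽₅)`
of order prime to `5`.  From L2 (regime split `5 ∣ |G|` ⇒ `G = ⊤ ∋ 2·1`, L8 / `5 ∤ |G|`, L7),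
L3/L4, L5, L6. [cite: DarmonDiamondTaylor1995, Thm. 2.49] -/
theorem ddt249_inputs_five (G : Subgroup G5) (hdet : DetSurjective G)
    (hsq : Submodule.span (ZMod 5) (sqDetMatrices G) = ⊤) :
    TwH1Vanishes G ∧
    (∀ X : M2, X.trace = 0 → (∀ g : G, twAd (g : G5) X = X) → X = 0) ∧
    (∀ N : Submodule (ZMod 5) M2, N ≠ ⊥ → (∀ X ∈ N, X.trace = 0) →
      (∀ g : G, ∀ X ∈ N, twAd (g : G5) X ∈ N) →
      ∃ g : G, Matrix.GeneralLinearGroup.det (g : G5) = 1 ∧ ((g : G5) : M2) ≠ 1 ∧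
        ((g : G5) : M2) ≠ -1 ∧ ¬ 5 ∣ orderOf (g : G5) ∧
        ∃ X ∈ N, X ≠ 0 ∧ ((g : G5) : M2) * X = X * ((g : G5) : M2)) := by
  sorry

end Summit.ABC.ABC.Cruxes.FreyModularity.StubIdeas.LiftFive2g15
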